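import Summits.Ventures.DiscreteObjects.MOLS.PlaneIffMOLS
import Summits.Ventures.DiscreteObjects.MOLS.TargetMOLS10

/-!
# Deficiency one: `n - 2` MOLS(n) complete to `n - 1` MOLS(n); PP(12) ⇔ 10 MOLS(12) (kernel)
Framing: lottery ticket; floor = certified bounds/negative ranges.

Cell pub-namedobj (venture DiscreteObjects), target (M), designs gen 9.  The classical completion theorem for nets of deficiency
one (a net of order `n` with `n` parallel classes — rows, columns and `n - 2` pairwise orthogonal Latin squares — extends to an
affine plane; e.g. Dénes–Keedwell, Latin Squares, Thm 8.2.x; Bruck 1963 §1): **`exists_completion`** — if `|ι| + 2 = n` and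
`Ls : ι → Fin n → Fin n → Fin n` are Latin and pairwise orthogonal, there is a Latin square `S` orthogonal to every `Ls k`.
Proof (the textbook one, in coordinates; `val` of `PlaneOfMOLS`): two cells are *joined* if they agree in some parallel class; a
cell `p` is unjoined to exactly one cell of every line not through it (`card_unjoined_on_line`: the other `n - 1` classes through
`p` meet the line in `n - 1` distinct cells), so the class `T p = {p} ∪ {cells unjoined to p}` has `n` cells (`card_T`), the
classes `T p` form a partition (`T_eq_of_mem`), and `S p :=` the column of the cell of `T p` in row `0` is the missing square.
Consequences: **`existsPlane_iff_MOLS_deficiency_one`** (`2 ≤ n`: a projective plane of order `n` exists iff `n - 2` MOLS(n)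
do), **`existsPlaneOrder12_iff_ten_MOLS`** (target (M-b): TEN pairwise orthogonal Latin squares of order 12 already suffice), and
**`card_MOLS10_le_seven_of_noPlane10`** (under the hypothesis ¬PP(10): at most 7 MOLS(10); the printed `N(10) ≤ 6` needs
Shrikhande's deficiency-two theorem, not formalised).  Classical; formalisation ours; no `sorry`.
-/

namespace Summit.Ventures.DiscreteObjects.MOLS

open Function Finset Configuration Literature.Combinatorics.Designs.LatinSquares
open scoped Classical

section Net

variable {ι : Type*} {n : ℕ} {Ls : ι → Fin n → Fin n → Fin n}

/-- the coordinate of the cell `x` in the parallel class `c` (`inl k`: symbol of square `k`; `inr false`: row; `inr true`: column) -/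
def coord (Ls : ι → Fin n → Fin n → Fin n) (c : ι ⊕ Bool) (x : Fin n × Fin n) : Fin n := val Ls c x.1 x.2

/-- `x` is joined (or equal) to `p`: they agree in some parallel class -/
def JE (Ls : ι → Fin n → Fin n → Fin n) (p x : Fin n × Fin n) : Prop := ∃ c, coord Ls c x = coord Ls c p

/-- the class of `p`: `p` together with the cells unjoined to `p` -/
noncomputable def T (Ls : ι → Fin n → Fin n → Fin n) (p : Fin n × Fin n) : Finset (Fin n × Fin n) :=
  univ.filter fun x => x = p ∨ ¬ JE Ls p x

/-- membership in the class of `p` -/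
theorem mem_T {p x : Fin n × Fin n} : x ∈ T Ls p ↔ x = p ∨ ¬ JE Ls p x := by
  simp [T]

/-- `p` is in its own class -/
theorem self_mem_T (p : Fin n × Fin n) : p ∈ T Ls p := mem_T.mpr (Or.inl rfl)

/-- a class different from a given one (rows or columns) -/
theorem exists_ne_class (c : ι ⊕ Bool) : ∃ c' : ι ⊕ Bool, c' ≠ c := by
  rcases c with k | b
  · exact ⟨Sum.inr false, by simp⟩
  · exact ⟨Sum.inr (!b), by cases b <;> simp⟩

/-- a line (the cells with coordinate `s` in class `c`) -/
theorem mem_line {c : ι ⊕ Bool} {s : Fin n} {x : Fin n × Fin n} :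
    x ∈ (univ.filter fun x => coord Ls c x = s) ↔ coord Ls c x = s := by simp

/-- the cells of `T p` on a line not through `p` are the cells of the line unjoined to `p` -/
theorem T_filter_line_eq (p : Fin n × Fin n) {c : ι ⊕ Bool} {s : Fin n} (hs : coord Ls c p ≠ s) :
    ((T Ls p).filter fun x => coord Ls c x = s) =
      (univ.filter fun x : Fin n × Fin n => coord Ls c x = s).filter fun x => ¬ JE Ls p x := by
  ext x
  simp only [T, mem_filter, mem_univ, true_and]
  constructor
  · rintro ⟨hx | hx, hxs⟩
    · exact absurd (hx ▸ hxs) hs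
    · exact ⟨hxs, hx⟩
  · rintro ⟨hxs, hx⟩
    exact ⟨Or.inr hx, hxs⟩

/-- the only cell of `T p` on a line through `p` is `p` -/
theorem T_filter_line_self (p : Fin n × Fin n) (c : ι ⊕ Bool) :
    ((T Ls p).filter fun x => coord Ls c x = coord Ls c p) = {p} := by
  ext x
  simp only [T, mem_filter, mem_univ, true_and, mem_singleton, JE, not_exists]
  constructor
  · rintro ⟨hx | hx, hxs⟩
    · exact hx
    · exact absurd hxs (hx c)
  · rintro rfl
    exact ⟨Or.inl rfl, rfl⟩

/-- cells of one class that are joined are equal -/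
theorem eq_of_T_eq_of_JE {x y : Fin n × Fin n} (hT : T Ls x = T Ls y) (hj : JE Ls x y) :
    x = y := by
  have hy : y ∈ T Ls x := hT ▸ self_mem_T y
  rcases mem_T.mp hy with h | h
  · exact h.symm
  · exact absurd hj h

variable (hL : ∀ k, IsLatinSquare (Ls k)) (hO : ∀ k k', k ≠ k' → IsOrthogonalMate (Ls k) (Ls k'))
include hL hO

/-- two distinct classes read the cells injectively (`PlaneOfMOLS.val_pair_injective`) -/
theorem coord_pair_injective {c c' : ι ⊕ Bool} (hcc : c ≠ c') :
    Injective fun x : Fin n × Fin n => (coord Ls c x, coord Ls c' x) :=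
  val_pair_injective hL hO hcc

/-- … and surjectively -/
theorem coord_pair_surjective {c c' : ι ⊕ Bool} (hcc : c ≠ c') (s t : Fin n) :
    ∃ x : Fin n × Fin n, coord Ls c x = s ∧ coord Ls c' x = t := by
  obtain ⟨x, hx⟩ := (val_pair_bijective hL hO hcc).2 (s, t)
  simp only [Prod.mk.injEq] at hx
  exact ⟨x, hx.1, hx.2⟩

/-- cells agreeing in two distinct classes are equal -/
theorem eq_of_coord_eq {c c' : ι ⊕ Bool} (hcc : c ≠ c') {x y : Fin n × Fin n} (h1 : coord Ls c x = coord Ls c y)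
    (h2 : coord Ls c' x = coord Ls c' y) : x = y :=
  coord_pair_injective hL hO hcc (Prod.ext h1 h2)

/-- **every line has `n` cells** -/
theorem card_line (c : ι ⊕ Bool) (s : Fin n) : (univ.filter fun x : Fin n × Fin n => coord Ls c x = s).card = n := by
  obtain ⟨c', hc'⟩ := exists_ne_class c
  have hinj : Set.InjOn (coord Ls c') ↑(univ.filter fun x : Fin n × Fin n => coord Ls c x = s) := by
    intro x hx y hy hxy
    simp only [coe_filter, Set.mem_setOf_eq, mem_univ, true_and] at hx hy
    exact eq_of_coord_eq hL hO (Ne.symm hc') (hx.trans hy.symm) hxy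
  have himg : (univ.filter fun x : Fin n × Fin n => coord Ls c x = s).image (coord Ls c') = univ := by
    ext t
    simp only [mem_image, mem_filter, mem_univ, true_and, iff_true]
    obtain ⟨x, hx1, hx2⟩ := coord_pair_surjective hL hO (Ne.symm hc') s t
    exact ⟨x, hx1, hx2⟩
  rw [← card_image_of_injOn hinj, himg, card_univ, Fintype.card_fin]

variable [Fintype ι]

/-- **A cell off a line is joined to exactly `|classes| - 1` of its cells** — one for each other parallel class. -/
theorem card_joined_on_line (p : Fin n × Fin n) {c : ι ⊕ Bool} {s : Fin n} (hs : coord Ls c p ≠ s) :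
    ((univ.filter fun x : Fin n × Fin n => coord Ls c x = s).filter fun x => JE Ls p x).card =
      Fintype.card (ι ⊕ Bool) - 1 := by
  -- the cell of the line matching `p` in class `c'`
  have hex : ∀ c' : ι ⊕ Bool, c' ≠ c → ∃ x : Fin n × Fin n, coord Ls c x = s ∧ coord Ls c' x = coord Ls c' p :=
    fun c' hc' => coord_pair_surjective hL hO (Ne.symm hc') s _
  let φ : ι ⊕ Bool → Fin n × Fin n := fun c' => if h : c' ≠ c then Classical.choose (hex c' h) else p
  have hφ : ∀ {c'}, c' ≠ c → coord Ls c (φ c') = s ∧ coord Ls c' (φ c') = coord Ls c' p := by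
    intro c' hc'
    simp only [φ, hc', ne_eq, not_false_eq_true, dif_pos]
    exact Classical.choose_spec (hex c' hc')
  have heq : ((univ.filter fun x : Fin n × Fin n => coord Ls c x = s).filter fun x => JE Ls p x) =
      (univ.erase c).image φ := by
    ext x
    simp only [mem_filter, mem_univ, true_and, mem_image, mem_erase, JE]
    constructor
    · rintro ⟨hx, c', hc'⟩
      have hc'c : c' ≠ c := by rintro rfl; exact hs (hc'.symm.trans hx)
      refine ⟨c', ⟨hc'c, trivial⟩, ?_⟩
      obtain ⟨h1, h2⟩ := hφ hc'c
      exact eq_of_coord_eq hL hO (Ne.symm hc'c) (h1.trans hx.symm) (h2.trans hc'.symm)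
    · rintro ⟨c', ⟨hc'c, -⟩, rfl⟩
      obtain ⟨h1, h2⟩ := hφ hc'c
      exact ⟨h1, c', h2⟩
  have hinj : Set.InjOn φ ↑(univ.erase c) := by
    intro c' hc' c'' hc'' e
    simp only [coe_erase, coe_univ, Set.mem_sdiff, Set.mem_univ, Set.mem_singleton_iff, true_and] at hc' hc''
    by_contra hne
    obtain ⟨h1, h2⟩ := hφ hc'
    obtain ⟨-, h3⟩ := hφ hc''
    rw [e] at h2
    have : φ c'' = p := eq_of_coord_eq hL hO hne h2 h3
    rw [e, this] at h1
    exact hs h1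
  rw [heq, card_image_of_injOn hinj, card_erase_of_mem (mem_univ c), card_univ]

/-- **A cell off a line is unjoined to exactly ONE of its cells** (deficiency one: `|classes| = n`). -/
theorem card_unjoined_on_line (hC : Fintype.card ι + 2 = n) (p : Fin n × Fin n) {c : ι ⊕ Bool} {s : Fin n}
    (hs : coord Ls c p ≠ s) :
    ((univ.filter fun x : Fin n × Fin n => coord Ls c x = s).filter fun x => ¬ JE Ls p x).card = 1 := by
  have h1 := card_filter_add_card_filter_not (s := univ.filter fun x : Fin n × Fin n => coord Ls c x = s)
    (fun x => JE Ls p x)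
  rw [card_joined_on_line hL hO p hs, card_line hL hO, Fintype.card_sum, Fintype.card_bool] at h1
  omega

/-- **`T p` meets every line in exactly one cell.** -/
theorem card_T_filter_line (hC : Fintype.card ι + 2 = n) (p : Fin n × Fin n) (c : ι ⊕ Bool) (s : Fin n) :
    ((T Ls p).filter fun x => coord Ls c x = s).card = 1 := by
  by_cases hs : coord Ls c p = s
  · subst hs
    rw [T_filter_line_self, card_singleton]
  · rw [T_filter_line_eq p hs, card_unjoined_on_line hL hO hC p hs]

/-- **`T p` has `n` cells.** -/
theorem card_T (hC : Fintype.card ι + 2 = n) (p : Fin n × Fin n) : (T Ls p).card = n := by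
  rw [card_eq_sum_card_fiberwise (f := coord Ls (Sum.inr false)) (t := univ) (fun _ _ => mem_univ _)]
  simp_rw [card_T_filter_line hL hO hC p (Sum.inr false)]
  simp

/-- **The classes `T p` form a partition:** a cell of `T p` has the same class. -/
theorem T_eq_of_mem (hC : Fintype.card ι + 2 = n) {p q : Fin n × Fin n} (hq : q ∈ T Ls p) : T Ls q = T Ls p := by
  by_cases hqp : q = p
  · rw [hqp]
  have hqun : ¬ JE Ls p q := (mem_T.mp hq).resolve_left hqp
  symm
  apply eq_of_subset_of_card_le _ (by rw [card_T hL hO hC, card_T hL hO hC])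
  intro x hx
  rw [mem_T]
  by_contra hnot
  simp only [not_or, not_not] at hnot
  obtain ⟨hxq, c, hc⟩ := hnot
  -- `x` and `q` lie on the line `(c, s)`, `s := coord c q`, which misses `p`; both are unjoined to `p`
  have hs : coord Ls c p ≠ coord Ls c q := fun e => hqun ⟨c, e.symm⟩
  have hxp : x ≠ p := by rintro rfl; exact hs hc
  have hxun : ¬ JE Ls p x := (mem_T.mp hx).resolve_left hxp
  have h1 := card_unjoined_on_line hL hO hC p hs
  have hx' : x ∈ (univ.filter fun y : Fin n × Fin n => coord Ls c y = coord Ls c q).filter fun y => ¬ JE Ls p y := by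
    simp [hc, hxun]
  have hq' : q ∈ (univ.filter fun y : Fin n × Fin n => coord Ls c y = coord Ls c q).filter fun y => ¬ JE Ls p y := by
    simp [hqun]
  obtain ⟨a, ha⟩ := card_eq_one.mp h1
  rw [ha, mem_singleton] at hx' hq'
  exact hxq (hx'.trans hq'.symm)

/-! ### the missing square -/

/-- the representative of the class of `p` in row `0` exists uniquely (`2 ≤ n`) -/
theorem exists_rep (hC : Fintype.card ι + 2 = n) (p : Fin n × Fin n) :
    ∃ y, ((T Ls p).filter fun x => coord Ls (Sum.inr false) x = ⟨0, by omega⟩) = {y} :=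
  card_eq_one.mp (card_T_filter_line hL hO hC p _ _)

/-- **the missing square:** `S p :=` the column of the cell of the class of `p` in row `0` -/
noncomputable def compl (hC : Fintype.card ι + 2 = n) (p : Fin n × Fin n) : Fin n :=
  (Classical.choose (exists_rep hL hO hC p)).2

/-- the representative lies in `T p` and in row `0` -/
theorem rep_spec (hC : Fintype.card ι + 2 = n) (p : Fin n × Fin n) :
    Classical.choose (exists_rep hL hO hC p) ∈ T Ls p ∧ (Classical.choose (exists_rep hL hO hC p)).1 = ⟨0, by omega⟩ := by
  have h := Classical.choose_spec (exists_rep hL hO hC p)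
  have hm : Classical.choose (exists_rep hL hO hC p) ∈
      (T Ls p).filter fun x => coord Ls (Sum.inr false) x = ⟨0, by omega⟩ := by
    have := mem_singleton_self (Classical.choose (exists_rep hL hO hC p)); rwa [← h] at this
  rw [mem_filter] at hm
  exact ⟨hm.1, hm.2⟩

/-- **cells with the same `S`-value lie in the same class** -/
theorem T_eq_of_compl_eq (hC : Fintype.card ι + 2 = n) {x y : Fin n × Fin n} (h : compl hL hO hC x = compl hL hO hC y) :
    T Ls x = T Ls y := by
  obtain ⟨hx1, hx2⟩ := rep_spec hL hO hC x
  obtain ⟨hy1, hy2⟩ := rep_spec hL hO hC y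
  have hrep : Classical.choose (exists_rep hL hO hC x) = Classical.choose (exists_rep hL hO hC y) :=
    Prod.ext (hx2.trans hy2.symm) h
  rw [← T_eq_of_mem hL hO hC hx1, hrep, T_eq_of_mem hL hO hC hy1]

/-- **Deficiency-one completion:** `n - 2` pairwise orthogonal Latin squares of order `n` (`|ι| + 2 = n`) have a common
orthogonal mate that is itself Latin — i.e. they extend to a complete set of `n - 1` MOLS(n). -/
theorem exists_completion (hC : Fintype.card ι + 2 = n) :
    ∃ S : Fin n → Fin n → Fin n, IsLatinSquare S ∧ ∀ k, IsOrthogonalMate (Ls k) S := by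
  refine ⟨fun i b => compl hL hO hC (i, b), ⟨fun i => ?_, fun b => ?_⟩, fun k => ?_⟩
  · intro b b' e
    have := eq_of_T_eq_of_JE (T_eq_of_compl_eq hL hO hC e) ⟨Sum.inr false, rfl⟩
    simpa using this
  · intro i i' e
    have := eq_of_T_eq_of_JE (T_eq_of_compl_eq hL hO hC e) ⟨Sum.inr true, rfl⟩
    simpa using this
  · rintro ⟨i, b⟩ ⟨i', b'⟩ e
    simp only [Prod.mk.injEq] at e
    exact eq_of_T_eq_of_JE (T_eq_of_compl_eq hL hO hC e.2) ⟨Sum.inl k, by simpa [coord, val] using e.1.symm⟩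

end Net

/-! ### Consequences -/

/-- `n - 2` MOLS(n) extend to `n - 1` MOLS(n), as an indexed family on `Option ι` -/
theorem exists_extension {ι : Type*} [Fintype ι] {n : ℕ} (Ls : ι → Fin n → Fin n → Fin n)
    (hL : ∀ k, IsLatinSquare (Ls k)) (hO : ∀ k k', k ≠ k' → IsOrthogonalMate (Ls k) (Ls k')) (hC : Fintype.card ι + 2 = n) :
    ∃ Ms : Option ι → Fin n → Fin n → Fin n, (∀ k, IsLatinSquare (Ms k)) ∧
      (∀ k k', k ≠ k' → IsOrthogonalMate (Ms k) (Ms k')) ∧ ∀ k, Ms (some k) = Ls k := by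
  obtain ⟨S, hS, hSO⟩ := exists_completion hL hO hC
  refine ⟨fun o => o.elim S Ls, ?_, ?_, fun k => rfl⟩
  · rintro (_ | k)
    · exact hS
    · exact hL k
  · rintro (_ | k) (_ | k') hkk
    · exact absurd rfl hkk
    · exact isOrthogonalMate_symm (hSO k')
    · exact hSO k
    · exact hO k k' fun e => hkk (congrArg some e)

/-- **A projective plane of order `n ≥ 2` exists iff `n - 2` MOLS(n) exist.** -/
theorem existsPlane_iff_MOLS_deficiency_one {n : ℕ} (hn : 2 ≤ n) :
    ExistsProjectivePlaneOrder n ↔ ∃ Ls : Fin (n - 2) → Fin n → Fin n → Fin n,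
      (∀ k, IsLatinSquare (Ls k)) ∧ ∀ k k', k ≠ k' → IsOrthogonalMate (Ls k) (Ls k') := by
  constructor
  · intro h
    obtain ⟨Ls, hL, hO⟩ := (existsPlane_iff_MOLS hn).1 h
    refine ⟨fun k => Ls (Fin.castLE (by omega) k), fun k => hL _, fun k k' hkk => hO _ _ fun e => hkk ?_⟩
    exact Fin.castLE_injective _ e
  · rintro ⟨Ls, hL, hO⟩
    have hC : Fintype.card (Fin (n - 2)) + 2 = n := by rw [Fintype.card_fin]; omega
    obtain ⟨Ms, hM, hMO, -⟩ := exists_extension Ls hL hO hC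
    have hι : Fintype.card (Option (Fin (n - 2))) + 1 = n := by rw [Fintype.card_option, Fintype.card_fin]; omega
    exact ⟨MPt Ms, MLn Ms, inferInstance, inferInstance, inferInstance, planeOfMOLS hM hMO hn hι,
      order_planeOfMOLS hM hMO hn hι⟩

/-- **Target (M-b) needs only TEN squares:** a projective plane of order 12 exists iff there are ten pairwise orthogonal Latin
squares of order 12. -/
theorem existsPlaneOrder12_iff_ten_MOLS :
    ExistsProjectivePlaneOrder12 ↔ ∃ Ls : Fin 10 → Fin 12 → Fin 12 → Fin 12,
      (∀ k, IsLatinSquare (Ls k)) ∧ ∀ k k', k ≠ k' → IsOrthogonalMate (Ls k) (Ls k') :=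
  existsPlaneOrder12_iff.trans (existsPlane_iff_MOLS_deficiency_one (n := 12) (by norm_num))

/-- **The MOLS(10) upper floor modulo Lam, sharpened:** if there is no projective plane of order 10 then any family of pairwise
orthogonal Latin squares of order 10 has at most 7 members. -/
theorem card_MOLS10_le_seven_of_noPlane10 (hLam : ¬ ExistsProjectivePlaneOrder 10) {ι : Type*} [Fintype ι]
    (Ls : ι → Fin 10 → Fin 10 → Fin 10) (hL : ∀ k, IsLatinSquare (Ls k)) (hO : ∀ k k', k ≠ k' → IsOrthogonalMate (Ls k) (Ls k')) :
    Fintype.card ι ≤ 7 := by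
  have h8 := card_MOLS10_le_eight_of_noPlane10 hLam Ls hL hO
  by_contra hlt
  have hcard : Fintype.card ι = 8 := by omega
  obtain ⟨Ms, hM, hMO, -⟩ := exists_extension Ls hL hO (by rw [hcard])
  have h9 := card_MOLS10_le_eight_of_noPlane10 hLam Ms hM hMO
  rw [Fintype.card_option, hcard] at h9
  omega

/-- likewise for order 12: without a projective plane of order 12 there are at most 9 MOLS(12) -/
theorem card_MOLS12_le_nine_of_noPlane12 (h12 : ¬ ExistsProjectivePlaneOrder12) {ι : Type*} [Fintype ι]
    (Ls : ι → Fin 12 → Fin 12 → Fin 12) (hL : ∀ k, IsLatinSquare (Ls k)) (hO : ∀ k k', k ≠ k' → IsOrthogonalMate (Ls k) (Ls k')) :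
    Fintype.card ι ≤ 9 := by
  have h10 := card_MOLS12_le_ten_of_noPlane12 h12 Ls hL hO
  by_contra hlt
  have hcard : Fintype.card ι = 10 := by omega
  obtain ⟨Ms, hM, hMO, -⟩ := exists_extension Ls hL hO (by rw [hcard])
  have h11 := card_MOLS12_le_ten_of_noPlane12 h12 Ms hM hMO
  rw [Fintype.card_option, hcard] at h11
  omega

end Summit.Ventures.DiscreteObjects.MOLS
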